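import Mathlib
import HarnessLib
import Summits.QuantumAdvantage.QuantumAdvantage.Theses.FeatureShadow
import Summits.QuantumAdvantage.AdviceFreeQNC0.FeatOfVPE
import Summits.QuantumAdvantage.AdviceFreeQNC0.PredHard
import Summits.QuantumAdvantage.AdviceFreeQNC0.WalkHardFShots
import Summits.QuantumAdvantage.AdviceFreeQNC0.BlockParityChar
import Literature.Computability.MetaComplexity.SmolenskyCorrelationRestrict
import Literature.Computability.MetaComplexity.LowDegreeComposition
import Summits.QuantumAdvantage.AdviceFreeQNC0.TransferWalk

set_option linter.dupNamespace false -- D-0017: single-problem summit ⇒ `QuantumAdvantage.QuantumAdvantage` by design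

/-!
# PairFreezing (LAND-READY EXTRACTION) — proofs of route-QuantumAdvantage-FeatureShadow items

(v3: + §9 `featureRungLogOdd_holds` — the feature rung for up to `log₂ n / 7` features, `WalkHardFFeatLog p`.)

decomp-qadv lens 4, generation 4.  Tree imports only; namespace `…Theorems.PairFreezing`; 0 sorry; axioms standard.
Closing theorems BY NAME of the route decls (`Theses/FeatureShadow.lean` rev 1):

* `featureRungOdd_holds : FeatureShadow.FeatureRungOdd` — item stmt-QuantumAdvantage-26996 (crux r3) PROVED;
* `denseEdgeOdd_holds : FeatureShadow.DenseEdgeOdd` — item 27654 PROVED;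
* `shadowGlue_holds : FeatureShadow.ShadowGlue` — item 26997 PROVED (g2's glue, re-proved import-clean);
* `target_of_residual : FeatureShadow.NearPerfectFeatureShadow → FeatureShadow.Target`,
  `adviceFreeQNC0Odd_of_residual : FeatureShadow.NearPerfectFeatureShadow → AdviceFreeQNC0Odd`.

Also, standalone: `walkHardFFeat_holds (p) [Fact p.Prime] (hp2 : p ≠ 2) (hp3 : p ≠ 3) : WalkHardFFeat p` (the tree's
OPEN dense rung `AdviceFreeQNC0/FeatOfVPE.lean:60`) and the dense-table law `denseLoseHalfF_holds`.
Proposal shape (prover/writer lane): `ledger propose --kind proof --target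
Summits/QuantumAdvantage/QuantumAdvantage/Theorems/PairFreezing.lean --workitem stmt-QuantumAdvantage-26996` (closes 26996;
`--supports` 26997 / 27654).  Mechanism summary: see the node file `PairFreezing.lean` §1.
-/

noncomputable section

namespace Summit.QuantumAdvantage.QuantumAdvantage.Theorems.PairFreezing

open Classical Finset Summit.QuantumAdvantage.AdviceFreeQNC0
open Literature.Computability.MetaComplexity Literature.Computability.MetaComplexity.Smolensky
open Literature.Computability.Complexity (parityFn)
open Summit.QuantumAdvantage.QuantumAdvantage.Theses
open Summit.QuantumAdvantage.AdviceFreeQNC0.TransferWalk (wtPrefix_zero)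

variable {n : ℕ}

/-! ### §2 Pair calculus: pairings, flip masks, walk invariants -/

/-- a pairing of the coordinates of `{0,1}ⁿ`: disjoint pairs `(o + 2i, o + 2i + 1)`, `i < P`; the other coordinates are
singletons. -/
structure Pairing (n : ℕ) where
  o : ℕ
  P : ℕ
  le : o + 2 * P ≤ n

namespace Pairing

variable (π : Pairing n)

/-- first coordinate of pair `i`. -/
def fst (i : Fin π.P) : Fin n := ⟨π.o + 2 * i.val, by have := π.le; omega⟩
/-- second coordinate of pair `i`. -/
def snd (i : Fin π.P) : Fin n := ⟨π.o + 2 * i.val + 1, by have := π.le; omega⟩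
/-- the middle cut of pair `i` (between its two coordinates). -/
def mid (i : Fin π.P) : Fin (n + 1) := ⟨π.o + 2 * i.val + 1, by have := π.le; omega⟩

/-- Pair-freezing helper `fst_val` (lens-4 g4 machinery; see the enclosing section docstring). -/
@[simp] theorem fst_val (i : Fin π.P) : (π.fst i).val = π.o + 2 * i.val := rfl
/-- Pair-freezing helper `snd_val` (lens-4 g4 machinery; see the enclosing section docstring). -/
@[simp] theorem snd_val (i : Fin π.P) : (π.snd i).val = π.o + 2 * i.val + 1 := rfl
/-- Pair-freezing helper `mid_val` (lens-4 g4 machinery; see the enclosing section docstring). -/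
@[simp] theorem mid_val (i : Fin π.P) : (π.mid i).val = π.o + 2 * i.val + 1 := rfl

/-- Pair-freezing helper `fst_injective` (lens-4 g4 machinery; see the enclosing section docstring). -/
theorem fst_injective : Function.Injective π.fst := by
  intro i j h
  have := congrArg Fin.val h
  simp only [fst_val] at this
  exact Fin.ext (by omega)

/-- Pair-freezing helper `snd_injective` (lens-4 g4 machinery; see the enclosing section docstring). -/
theorem snd_injective : Function.Injective π.snd := by
  intro i j h
  have := congrArg Fin.val h
  simp only [snd_val] at this
  exact Fin.ext (by omega)

/-- Pair-freezing helper `mid_injective` (lens-4 g4 machinery; see the enclosing section docstring). -/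
theorem mid_injective : Function.Injective π.mid := by
  intro i j h
  have := congrArg Fin.val h
  simp only [mid_val] at this
  exact Fin.ext (by omega)

/-- Pair-freezing helper `fst_ne_snd` (lens-4 g4 machinery; see the enclosing section docstring). -/
theorem fst_ne_snd (i j : Fin π.P) : π.fst i ≠ π.snd j := by
  intro h
  have := congrArg Fin.val h
  simp only [fst_val, snd_val] at this
  omega

/-- the flip mask of a set `J` of pairs: `true` exactly on the coordinates of the pairs in `J`. -/
def mask (J : Finset (Fin π.P)) (j : Fin n) : Bool := decide (∃ i ∈ J, j = π.fst i ∨ j = π.snd i)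

/-- flipping (negating both coordinates of) the pairs in `J`; on anti-correlated pairs this swaps the two bits. -/
def flip (u : Fin n → Bool) (J : Finset (Fin π.P)) : Fin n → Bool := fun j => xor (u j) (π.mask J j)

/-- Pair-freezing helper `mask_fst` (lens-4 g4 machinery; see the enclosing section docstring). -/
theorem mask_fst (J : Finset (Fin π.P)) (i : Fin π.P) : π.mask J (π.fst i) = decide (i ∈ J) := by
  unfold mask
  by_cases hi : i ∈ J
  · rw [decide_eq_true hi, decide_eq_true_iff]
    exact ⟨i, hi, Or.inl rfl⟩
  · rw [decide_eq_false hi, decide_eq_false_iff_not]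
    rintro ⟨i', hi', h | h⟩
    · exact hi (π.fst_injective h ▸ hi')
    · exact π.fst_ne_snd i i' h

/-- Pair-freezing helper `mask_snd` (lens-4 g4 machinery; see the enclosing section docstring). -/
theorem mask_snd (J : Finset (Fin π.P)) (i : Fin π.P) : π.mask J (π.snd i) = decide (i ∈ J) := by
  unfold mask
  by_cases hi : i ∈ J
  · rw [decide_eq_true hi, decide_eq_true_iff]
    exact ⟨i, hi, Or.inr rfl⟩
  · rw [decide_eq_false hi, decide_eq_false_iff_not]
    rintro ⟨i', hi', h | h⟩
    · exact π.fst_ne_snd i' i h.symm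
    · exact hi (π.snd_injective h ▸ hi')

/-- off the coordinates of the pairs in `J` the mask vanishes. -/
theorem mask_eq_false {J : Finset (Fin π.P)} {j : Fin n} (h : ∀ i ∈ J, j ≠ π.fst i ∧ j ≠ π.snd i) :
    π.mask J j = false := by
  unfold mask
  rw [decide_eq_false_iff_not]
  rintro ⟨i, hi, h' | h'⟩
  · exact (h i hi).1 h'
  · exact (h i hi).2 h'

/-- Pair-freezing helper `mask_of_lt` (lens-4 g4 machinery; see the enclosing section docstring). -/
theorem mask_of_lt (J : Finset (Fin π.P)) {j : Fin n} (hj : j.val < π.o) : π.mask J j = false :=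
  π.mask_eq_false fun i _ => ⟨fun h => by have := congrArg Fin.val h; simp at this; omega,
    fun h => by have := congrArg Fin.val h; simp at this; omega⟩

/-- Pair-freezing helper `mask_of_ge` (lens-4 g4 machinery; see the enclosing section docstring). -/
theorem mask_of_ge (J : Finset (Fin π.P)) {j : Fin n} (hj : π.o + 2 * π.P ≤ j.val) : π.mask J j = false :=
  π.mask_eq_false fun i _ => ⟨fun h => by have := congrArg Fin.val h; simp at this; omega,
    fun h => by have := congrArg Fin.val h; simp at this; omega⟩

/-- Pair-freezing helper `flip_fst` (lens-4 g4 machinery; see the enclosing section docstring). -/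
@[simp] theorem flip_fst (u : Fin n → Bool) (J : Finset (Fin π.P)) (i : Fin π.P) :
    π.flip u J (π.fst i) = xor (u (π.fst i)) (decide (i ∈ J)) := by
  simp [flip, mask_fst]

/-- Pair-freezing helper `flip_snd` (lens-4 g4 machinery; see the enclosing section docstring). -/
@[simp] theorem flip_snd (u : Fin n → Bool) (J : Finset (Fin π.P)) (i : Fin π.P) :
    π.flip u J (π.snd i) = xor (u (π.snd i)) (decide (i ∈ J)) := by
  simp [flip, mask_snd]

/-- Pair-freezing helper `flip_of_mask_false` (lens-4 g4 machinery; see the enclosing section docstring). -/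
theorem flip_of_mask_false (u : Fin n → Bool) {J : Finset (Fin π.P)} {j : Fin n} (h : π.mask J j = false) :
    π.flip u J j = u j := by
  simp [flip, h]

/-- Pair-freezing helper `flip_flip` (lens-4 g4 machinery; see the enclosing section docstring). -/
theorem flip_flip (u : Fin n → Bool) (J : Finset (Fin π.P)) : π.flip (π.flip u J) J = u := by
  funext j
  simp [flip]

/-- Pair-freezing helper `flip_empty` (lens-4 g4 machinery; see the enclosing section docstring). -/
theorem flip_empty (u : Fin n → Bool) : π.flip u ∅ = u := by
  funext j
  simp [flip, mask]

/-- a pair stays (anti-)correlated under any flip. -/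
theorem flip_fst_ne_snd_iff (u : Fin n → Bool) (J : Finset (Fin π.P)) (i : Fin π.P) :
    π.flip u J (π.fst i) ≠ π.flip u J (π.snd i) ↔ u (π.fst i) ≠ u (π.snd i) := by
  rw [flip_fst, flip_snd]
  cases u (π.fst i) <;> cases u (π.snd i) <;> cases decide (i ∈ J) <;> simp

end Pairing

/-! #### prefix weights -/

/-- Pair-freezing helper `wtPrefix_succ` (lens-4 g4 machinery; see the enclosing section docstring). -/
theorem wtPrefix_succ (u : Fin n → Bool) {g : ℕ} (hg : g < n) :
    wtPrefix u (g + 1) = wtPrefix u g + (if u ⟨g, hg⟩ = true then 1 else 0) := by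
  unfold wtPrefix
  have hsplit : (univ.filter fun i : Fin n => i.val < g + 1 ∧ u i = true) =
      (univ.filter fun i : Fin n => i.val < g ∧ u i = true) ∪
        (univ.filter fun i : Fin n => i = ⟨g, hg⟩ ∧ u i = true) := by
    ext i
    simp only [mem_filter, mem_univ, true_and, mem_union]
    constructor
    · rintro ⟨h1, h2⟩
      rcases Nat.lt_succ_iff_lt_or_eq.1 h1 with h | h
      · exact Or.inl ⟨h, h2⟩
      · exact Or.inr ⟨Fin.ext h, h2⟩
    · rintro (⟨h1, h2⟩ | ⟨h1, h2⟩)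
      · exact ⟨by omega, h2⟩
      · exact ⟨by rw [h1]; exact Nat.lt_succ_self g, h2⟩
  have hdisj : Disjoint (univ.filter fun i : Fin n => i.val < g ∧ u i = true)
      (univ.filter fun i : Fin n => i = ⟨g, hg⟩ ∧ u i = true) := by
    rw [Finset.disjoint_filter]
    rintro i _ ⟨h1, _⟩ ⟨h2, _⟩
    rw [h2] at h1
    exact lt_irrefl _ h1
  rw [hsplit, card_union_of_disjoint hdisj]
  congr 1
  by_cases hu : u ⟨g, hg⟩ = true
  · rw [if_pos hu]
    have : (univ.filter fun i : Fin n => i = ⟨g, hg⟩ ∧ u i = true) = {⟨g, hg⟩} := by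
      ext i
      simp only [mem_filter, mem_univ, true_and, mem_singleton]
      constructor
      · rintro ⟨h, _⟩; exact h
      · intro h; exact ⟨h, h ▸ hu⟩
    rw [this, card_singleton]
  · rw [if_neg hu]
    have : (univ.filter fun i : Fin n => i = ⟨g, hg⟩ ∧ u i = true) = ∅ := by
      refine Finset.filter_eq_empty_iff.mpr fun i _ => ?_
      rintro ⟨h, h'⟩
      exact hu (h ▸ h')
    rw [this, card_empty]

/-- Pair-freezing helper `wtPrefix_of_le` (lens-4 g4 machinery; see the enclosing section docstring). -/
theorem wtPrefix_of_le (u : Fin n → Bool) {g : ℕ} (hg : n ≤ g) : wtPrefix u g = wt u := by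
  unfold wtPrefix Summit.QuantumAdvantage.AdviceFreeQNC0.wt
  congr 1
  refine Finset.filter_congr fun i _ => ?_
  constructor
  · rintro ⟨_, h⟩; exact h
  · intro h; exact ⟨by omega, h⟩

/-- two points that agree on the coordinates in `[g₀, g)` and have equal prefix weights at `g₀` have equal prefix
weights at `g`. -/
theorem wtPrefix_congr (u u' : Fin n → Bool) (g₀ g : ℕ) (hle : g₀ ≤ g) (hg : g ≤ n)
    (h0 : wtPrefix u' g₀ = wtPrefix u g₀) (heq : ∀ j : Fin n, g₀ ≤ j.val → j.val < g → u' j = u j) :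
    wtPrefix u' g = wtPrefix u g := by
  induction g, hle using Nat.le_induction with
  | base => exact h0
  | succ g hg₀ ih =>
    have hgn : g < n := by omega
    rw [wtPrefix_succ u' hgn, wtPrefix_succ u hgn, ih (by omega) fun j h1 h2 => heq j h1 (by omega),
      heq ⟨g, hgn⟩ hg₀ (Nat.lt_succ_self g)]

namespace Pairing

variable (π : Pairing n)

/-- even-position prefix weights are invariant under flipping anti-correlated pairs. -/
theorem wtPrefix_flip_even (u : Fin n → Bool) {J : Finset (Fin π.P)}
    (hJ : ∀ i ∈ J, u (π.fst i) ≠ u (π.snd i)) :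
    ∀ i : ℕ, i ≤ π.P → wtPrefix (π.flip u J) (π.o + 2 * i) = wtPrefix u (π.o + 2 * i) := by
  intro i
  induction i with
  | zero =>
    intro _
    rw [Nat.mul_zero, Nat.add_zero]
    refine wtPrefix_congr u (π.flip u J) 0 π.o (Nat.zero_le _) (by have := π.le; omega)
      (by rw [wtPrefix_zero, wtPrefix_zero]) fun j _ hj => ?_
    exact π.flip_of_mask_false u (π.mask_of_lt J hj)
  | succ i ih =>
    intro hi
    have hP := π.le
    have h1 : π.o + 2 * i < n := by omega
    have h2 : π.o + 2 * i + 1 < n := by omega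
    have e1 : π.o + 2 * (i + 1) = (π.o + 2 * i + 1) + 1 := by ring
    rw [e1, wtPrefix_succ _ h2, wtPrefix_succ _ h1, wtPrefix_succ _ h2, wtPrefix_succ _ h1, ih (by omega)]
    have hf : (⟨π.o + 2 * i, h1⟩ : Fin n) = π.fst ⟨i, by omega⟩ := Fin.ext (by simp)
    have hs : (⟨π.o + 2 * i + 1, h2⟩ : Fin n) = π.snd ⟨i, by omega⟩ := Fin.ext (by simp)
    rw [hf, hs, flip_fst, flip_snd]
    by_cases hmem : (⟨i, by omega⟩ : Fin π.P) ∈ J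
    · have hne := hJ _ hmem
      rw [decide_eq_true hmem]
      revert hne
      cases u (π.fst ⟨i, by omega⟩) <;> cases u (π.snd ⟨i, by omega⟩) <;> simp
    · rw [decide_eq_false hmem]
      simp

/-- the total weight is invariant under flipping anti-correlated pairs. -/
theorem wt_flip (u : Fin n → Bool) {J : Finset (Fin π.P)} (hJ : ∀ i ∈ J, u (π.fst i) ≠ u (π.snd i)) :
    wt (π.flip u J) = wt u := by
  have hP := π.le
  rw [← wtPrefix_of_le (π.flip u J) (le_refl n), ← wtPrefix_of_le u (le_refl n)]
  refine wtPrefix_congr u (π.flip u J) (π.o + 2 * π.P) n hP (le_refl n)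
    (π.wtPrefix_flip_even u hJ π.P (le_refl _)) fun j hj _ => ?_
  exact π.flip_of_mask_false u (π.mask_of_ge J hj)

/-- `κ_i(u) = c + (o + 2i + 1) + |u| + |u_{< o + 2i}|` : the walk datum deciding what the free bit of pair `i` does at
its middle cut. -/
def kappa (c : ℕ) (u : Fin n → Bool) (i : Fin π.P) : ℕ :=
  c + (π.o + 2 * i.val + 1) + wt u + wtPrefix u (π.o + 2 * i.val)

/-- Pair-freezing helper `kappa_flip` (lens-4 g4 machinery; see the enclosing section docstring). -/
theorem kappa_flip (c : ℕ) (u : Fin n → Bool) {J : Finset (Fin π.P)}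
    (hJ : ∀ i ∈ J, u (π.fst i) ≠ u (π.snd i)) (i : Fin π.P) :
    π.kappa c (π.flip u J) i = π.kappa c u i := by
  unfold kappa
  rw [π.wt_flip u hJ, π.wtPrefix_flip_even u hJ i.val (le_of_lt i.isLt)]

/-- the RELEVANT FREE PAIRS of `u` for the fixed table `tab`: anti-correlated pairs whose middle cut is fired and
whose walk datum is `≢ 1 (mod 3)` (so that the orientation bit of the pair is read as a literal at that cut). -/
def rel (c : ℕ) (tab : Fin (n + 1) → Bool) (u : Fin n → Bool) : Finset (Fin π.P) :=
  univ.filter fun i => tab (π.mid i) = true ∧ u (π.fst i) ≠ u (π.snd i) ∧ π.kappa c u i % 3 ≠ 1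

/-- Pair-freezing helper `rel_subset_anti` (lens-4 g4 machinery; see the enclosing section docstring). -/
theorem rel_subset_anti (c : ℕ) (tab : Fin (n + 1) → Bool) (u : Fin n → Bool) :
    ∀ i ∈ π.rel c tab u, u (π.fst i) ≠ u (π.snd i) := by
  intro i hi
  unfold rel at hi
  rw [mem_filter] at hi
  exact hi.2.2.1

/-- Pair-freezing helper `rel_flip` (lens-4 g4 machinery; see the enclosing section docstring). -/
theorem rel_flip (c : ℕ) (tab : Fin (n + 1) → Bool) (u : Fin n → Bool) {J : Finset (Fin π.P)}
    (hJ : ∀ i ∈ J, u (π.fst i) ≠ u (π.snd i)) : π.rel c tab (π.flip u J) = π.rel c tab u := by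
  unfold rel
  refine Finset.filter_congr fun i _ => ?_
  rw [π.kappa_flip c u hJ i, π.flip_fst_ne_snd_iff]


/-- prefix weights at cuts other than the middle cuts of the flipped pairs are invariant. -/
theorem wtPrefix_flip_of_not_mid (u : Fin n → Bool) {J : Finset (Fin π.P)}
    (hJ : ∀ i ∈ J, u (π.fst i) ≠ u (π.snd i)) (h : Fin (n + 1)) (hh : ∀ i ∈ J, h ≠ π.mid i) :
    wtPrefix (π.flip u J) h.val = wtPrefix u h.val := by
  have hP := π.le
  have hhn : h.val ≤ n := Nat.lt_succ_iff.mp h.isLt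
  by_cases h1 : h.val ≤ π.o
  · refine wtPrefix_congr u (π.flip u J) 0 h.val (Nat.zero_le _) hhn
      (by rw [wtPrefix_zero, wtPrefix_zero]) fun j _ hj => ?_
    exact π.flip_of_mask_false u (π.mask_of_lt J (by omega))
  by_cases h2 : π.o + 2 * π.P ≤ h.val
  · refine wtPrefix_congr u (π.flip u J) (π.o + 2 * π.P) h.val h2 hhn
      (π.wtPrefix_flip_even u hJ π.P (le_refl _)) fun j hj _ => ?_
    exact π.flip_of_mask_false u (π.mask_of_ge J hj)
  rw [not_le] at h1 h2
  -- `o < h < o + 2P`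
  obtain ⟨i, hi⟩ : ∃ i : ℕ, h.val = π.o + 2 * i ∨ h.val = π.o + 2 * i + 1 :=
    ⟨(h.val - π.o) / 2, by omega⟩
  rcases hi with hi | hi
  · rw [hi]
    exact π.wtPrefix_flip_even u hJ i (by omega)
  · have hiP : i < π.P := by omega
    have hg : π.o + 2 * i < n := by omega
    rw [hi, wtPrefix_succ _ hg, wtPrefix_succ _ hg, π.wtPrefix_flip_even u hJ i (by omega)]
    have hf : (⟨π.o + 2 * i, hg⟩ : Fin n) = π.fst ⟨i, hiP⟩ := Fin.ext (by simp)
    have hnot : (⟨i, hiP⟩ : Fin π.P) ∉ J := by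
      intro hmem
      exact hh _ hmem (Fin.ext (by simp [hi]))
    rw [hf, flip_fst, decide_eq_false hnot, Bool.xor_false]

/-- Pair-freezing helper `walkExp_flip_of_not_mid` (lens-4 g4 machinery; see the enclosing section docstring). -/
theorem walkExp_flip_of_not_mid (u : Fin n → Bool) {J : Finset (Fin π.P)}
    (hJ : ∀ i ∈ J, u (π.fst i) ≠ u (π.snd i)) (h : Fin (n + 1)) (hh : ∀ i ∈ J, h ≠ π.mid i) :
    walkExp (π.flip u J) h.val = walkExp u h.val := by
  unfold walkExp
  rw [π.wt_flip u hJ, π.wtPrefix_flip_of_not_mid u hJ h hh]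

/-- at the middle cut of pair `i` the walk exponent reads `κ_i(u) − c − (o + 2i + 1) + [u (fst i)]`. -/
theorem walkExp_mid (c : ℕ) (u : Fin n → Bool) (i : Fin π.P) :
    c + (π.mid i).val + walkExp u (π.mid i).val =
      π.kappa c u i + (if u (π.fst i) = true then 1 else 0) := by
  have hP := π.le
  have hg : π.o + 2 * i.val < n := by omega
  unfold walkExp kappa
  rw [mid_val, wtPrefix_succ u hg]
  have hf : (⟨π.o + 2 * i.val, hg⟩ : Fin n) = π.fst i := Fin.ext (by simp)
  rw [hf]
  ring

/-- the charged fired cuts of the fixed table `tab` at input `v`. -/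
def chg (c : ℕ) (tab : Fin (n + 1) → Bool) (v : Fin n → Bool) : Finset (Fin (n + 1)) :=
  univ.filter fun g : Fin (n + 1) => tab g = true ∧ (c + g.val + walkExp v g.val) % 3 ≠ 0

/-- Pair-freezing helper `ringWinU_tab_eq` (lens-4 g4 machinery; see the enclosing section docstring). -/
theorem ringWinU_tab_eq (c : ℕ) (tab : Fin (n + 1) → Bool) (v : Fin n → Bool) :
    ringWinU c (fun h _ => tab h) v = decide ((chg c tab v).card % 2 = 1) := rfl

end Pairing
end Summit.QuantumAdvantage.QuantumAdvantage.Theorems.PairFreezing
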